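import Summits.KontsevichZagierPeriods.KontsevichZagierPeriods.Theses.LiftingCriteria
import Summits.KontsevichZagierPeriods.KontsevichZagierPeriods.Theorems.LiftingCriteriaDilationLiftAtOneLiouville

/-!
# F3 / BC5 WITNESS for the rung `DilationLiftAtOneDimOne`: the rung specialises to the PROVED floor

Self-contained companion of `Lines/dimone_asgt.lean` (crux `DilationLiftAtOne`, stmt-KontsevichZagierPeriods-3571):
the three `def`s below are VERBATIM copies of the line file's (a Lines file is not an importable module).
`special : DimOneLiftOn IsLiouvilleData` is the floor θ₀ of the graded family `DimOneLiftOn` — a 4-line repackaging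
of the landed `Summit.KontsevichZagierPeriods.LiftingCriteria.DilationLiftAtOne.dilationLiftAtOne_liouvilleSector`
(p166809, sorry-free; Baker's theorem on differences of logarithms) — and `onPath : DilationLiftAtOne → DilationLiftAtOneDimOne`
is the on-path certificate `crux → rung` (instantiation `S = n = 1`). No `sorry` in this file.
-/

noncomputable section

set_option linter.dupNamespace false

namespace Summit.KontsevichZagierPeriods.KontsevichZagierPeriods.Cruxes.DilationLiftAtOne.DimOneAsgt.Special

open scoped BigOperators
open MeasureTheory Set
open Summit.KontsevichZagierPeriods.KontsevichZagierPeriods.Theses.LiftingCriteria (DilationLiftAtOne)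

/-- **Graded family of the ladder inside dimension one.** `DimOneLiftOn adm`: for every
one-variable datum `h` of the admissibility class `adm` which is Nash (`ℚ`-semialgebraic and
real-analytic) on an interval `(a,b) ⊇ [0,1]` and has `∫₀¹ h = 0`, the dilation function
`v_h(ϖ) = ∫₀¹ h(ϖ x) dx` lifts on `[0,1]` in the crux's own format:
`v_h = (ϖ − 1)·(μ₀ + Σ_j μ_j v_{G_j})` with Nash cube functions `G_j` and polynomials `μ` with real
algebraic coefficients. Monotone in `adm`. Floor `adm = IsLiouvilleData` (landed, p166809); rung
`adm = ⊤` (`DilationLiftAtOneDimOne`). [cite: KontsevichZagier2001, §1.2] -/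
def DimOneLiftOn (adm : ℝ → ℝ → (ℝ → ℝ) → Prop) : Prop :=
  ∀ (a b : ℝ), a < 0 → 1 < b → ∀ (h : ℝ → ℝ), adm a b h → Literature.NumberTheory.Transcendental.IsSemialgebraicFunOn ℚ {t : Fin 1 → ℝ | t 0 ∈ Set.Ioo a b} (fun t => h (t 0)) → (∀ x ∈ Set.Ioo a b, AnalyticAt ℝ h x) → (∫ z in Set.pi Set.univ (fun _ : Fin 1 => Set.Icc (0:ℝ) 1), h (((1:ℝ) • z) 0)) = 0 → ∃ (T : ℕ) (d : Fin T → ℕ) (G : (j : Fin T) → (Fin (d j) → ℝ) → ℝ) (V : (j : Fin T) → Set (Fin (d j) → ℝ)) (μ : Fin T → Polynomial ℝ) (μ₀ : Polynomial ℝ), (∀ j, IsOpen (V j) ∧ Set.pi Set.univ (fun _ : Fin (d j) => Set.Icc (0:ℝ) 1) ⊆ (V j) ∧ Literature.NumberTheory.Transcendental.IsSemialgebraicFunOn ℚ (V j) (G j) ∧ AnalyticOnNhd ℝ (G j) (V j)) ∧ (∀ j k, IsAlgebraic ℚ ((μ j).coeff k)) ∧ (∀ k, IsAlgebraic ℚ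 (μ₀.coeff k)) ∧ ∀ ϖ ∈ Set.Icc (0:ℝ) 1, (∫ z in Set.pi Set.univ (fun _ : Fin 1 => Set.Icc (0:ℝ) 1), h ((ϖ • z) 0)) = (ϖ - 1) * (μ₀.eval ϖ + ∑ j, (μ j).eval ϖ * (∫ z in Set.pi Set.univ (fun _ : Fin (d j) => Set.Icc (0:ℝ) 1), G j (ϖ • z)))

/-- **Floor class θ₀ (PROVED, p166809 `stub_liouvilleSector`)**: one-variable data in LIOUVILLE
normal form `h = N' + Σ_k Re(c_k w_k'/w_k)` with Nash `N`, Nash loops `w_k = u_k + i v_k` in the slit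
plane and algebraic `c_k = γ_k + i δ_k` — every algebraic integrand with ELEMENTARY antiderivative
(⊇ genus-0 data ⊇ `ℚ(x)`); its periods are `ℚ̄`-linear forms in logarithms of algebraic numbers
(group `𝔾_a × 𝔾_m^A`). [cite: Baker1975, Thm. 2.1] -/
def IsLiouvilleData (a b : ℝ) (h : ℝ → ℝ) : Prop :=
  ∃ (N : ℝ → ℝ) (A : ℕ) (u v : Fin A → ℝ → ℝ) (γ δ : Fin A → ℝ),
    Literature.NumberTheory.Transcendental.IsSemialgebraicFunOn ℚ {t : Fin 1 → ℝ | t 0 ∈ Set.Ioo a b} (fun t => N (t 0)) ∧ (∀ x ∈ Set.Ioo a b, AnalyticAt ℝ N x) ∧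
    (∀ k, Literature.NumberTheory.Transcendental.IsSemialgebraicFunOn ℚ {t : Fin 1 → ℝ | t 0 ∈ Set.Ioo a b} (fun t => u k (t 0))) ∧
    (∀ k, Literature.NumberTheory.Transcendental.IsSemialgebraicFunOn ℚ {t : Fin 1 → ℝ | t 0 ∈ Set.Ioo a b} (fun t => v k (t 0))) ∧
    (∀ k, ∀ x ∈ Set.Ioo a b, AnalyticAt ℝ (u k) x) ∧ (∀ k, ∀ x ∈ Set.Ioo a b, AnalyticAt ℝ (v k) x) ∧
    (∀ k, ∀ x ∈ Set.Ioo a b, 0 < u k x ∨ v k x ≠ 0) ∧ (∀ k, IsAlgebraic ℚ (γ k)) ∧ (∀ k, IsAlgebraic ℚ (δ k)) ∧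
    h = fun x => deriv N x + ∑ k, (γ k * ((deriv (u k) x * u k x + deriv (v k) x * v k x) / (u k x ^ 2 + v k x ^ 2)) - δ k * ((deriv (v k) x * u k x - deriv (u k) x * v k x) / (u k x ^ 2 + v k x ^ 2)))

/-- **THE RUNG θ₁ (next statement of the ladder, OPEN — filed here as a line, not as an item):
`DilationLiftAtOne` for ALL one-variable Nash data (any genus of the underlying curve).** For `h`
Nash on `(a,b) ⊇ [0,1]` with `∫₀¹ h = 0`, `v_h ∈ (ϖ − 1)·(ℝ_alg[ϖ] + Σ ℝ_alg[ϖ]·D)` on `[0,1]`.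
One hypothesis of the floor generalised (elementary antiderivative ↦ arbitrary abelian integral);
the crux `DilationLiftAtOne` is this for Nash data of EVERY dimension (`dimOne_of_dilationLiftAtOne`
below is the on-path certificate `crux → rung`). Located attack: Wüstholz's analytic subgroup theorem
makes the Nash loop null-homotopic in a quotient group, and a straight-line homotopy in an algebraic
chart is a twisted-diagonal kernel (stubs N1, N2 below). [cite: HuberWuestholz2022, Thm. 13.3] -/
def DilationLiftAtOneDimOne : Prop :=
  DimOneLiftOn (fun _ _ _ => True)

/-- **Floor `θ₀` of the family (PROVED rung, = the witness of F3/BC5): Liouville data lift**, a thin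
repackaging of the landed `dilationLiftAtOne_liouvilleSector` (p166809; Baker's theorem on
differences of logarithms, sorry-free in the tree). [cite: Baker1975, Thm. 2.1] -/
theorem special : DimOneLiftOn IsLiouvilleData := by
  intro a b ha hb h hadm _ _ h1
  obtain ⟨N, A, u, v, γ, δ, hNs, hNa, hus, hvs, hua, hva, hslit, hγ, hδ, rfl⟩ := hadm
  have H := Summit.KontsevichZagierPeriods.LiftingCriteria.DilationLiftAtOne.dilationLiftAtOne_liouvilleSector
    a b ha hb N hNs hNa A u v hus hvs hua hva hslit γ δ hγ hδ 1 0 (by simpa using h1)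
  simpa using H


/-- The F3 line, literally. [cite: Baker1975, Thm. 2.1] -/
example : DimOneLiftOn IsLiouvilleData := special

/-- **On-path certificate: the crux implies the rung** (instantiate with `S = 1`, `n = 1`,
`g = fun t => h (t 0)`, `U = {t | t 0 ∈ (a,b)}`, `m = 1`, `m₀ = 0`). [cite: KontsevichZagier2001, §1.2] -/
theorem onPath (hL : DilationLiftAtOne) : DilationLiftAtOneDimOne := by
  intro a b ha hb h _ hs han h1
  have hUo : IsOpen {t : Fin 1 → ℝ | t 0 ∈ Set.Ioo a b} := isOpen_Ioo.preimage (continuous_apply 0)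
  have hUc : Set.pi Set.univ (fun _ : Fin 1 => Set.Icc (0:ℝ) 1) ⊆ {t : Fin 1 → ℝ | t 0 ∈ Set.Ioo a b} := by
    intro t ht
    have h0 : t 0 ∈ Set.Icc (0:ℝ) 1 := ht 0 (Set.mem_univ _)
    exact ⟨ha.trans_le h0.1, h0.2.trans_lt hb⟩
  have hUa : AnalyticOnNhd ℝ (fun t : Fin 1 → ℝ => h (t 0)) {t : Fin 1 → ℝ | t 0 ∈ Set.Ioo a b} := by
    intro t ht
    have h0 : AnalyticAt ℝ (fun p : Fin 1 → ℝ => p 0) t :=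
      (ContinuousLinearMap.proj (R := ℝ) (φ := fun _ : Fin 1 => ℝ) 0).analyticAt t
    exact AnalyticAt.comp (f := fun q : Fin 1 → ℝ => q 0) (han (t 0) ht) h0
  have hsum : ((0:ℤ) : ℝ) + ∑ i : Fin 1, ((fun _ => (1:ℤ)) i : ℝ) *
      (∫ z in Set.pi Set.univ (fun _ : Fin 1 => Set.Icc (0:ℝ) 1), (fun (_ : Fin 1) (t : Fin 1 → ℝ) => h (t 0)) i (((1:ℝ) • z))) = 0 := by
    simpa using h1
  obtain ⟨T, d, G, V, μ, μ₀, hG, hμ, hμ₀, hid⟩ :=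
    hL 1 (fun _ => 1) (fun _ t => h (t 0)) (fun _ => {t : Fin 1 → ℝ | t 0 ∈ Set.Ioo a b})
      (fun _ => ⟨hUo, hUc, hs, hUa⟩) (fun _ => 1) 0 hsum
  refine ⟨T, d, G, V, μ, μ₀, hG, hμ, hμ₀, ?_⟩
  intro ϖ hϖ
  have := hid ϖ hϖ
  simpa using this


end Summit.KontsevichZagierPeriods.KontsevichZagierPeriods.Cruxes.DilationLiftAtOne.DimOneAsgt.Special
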